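import Mathlib
import Literature.NumberTheory.LFunctions.FeketePolynomial
import Literature.RingTheory.Valuation.AlgClosedResidue
import Literature.RingTheory.Valuation.RootReduction
import Summits.ValiantsHypothesis.ValiantsHypothesis.Theses.FeketeSOS
import Summits.ValiantsHypothesis.ValiantsHypothesis.Theorems.FeketeSOSDepthZeroShadow
import Summits.ValiantsHypothesis.ValiantsHypothesis.Theorems.FeketeSOSSublinearShadowGramShadow

/-!
# `FeketeSOS.SublinearShadow` (stmt-ValiantsHypothesis-14990), line `Sketch`, reshape 5 — the NULL FORM at a Gram-deep place

What the open residual `stub_coreFewGramDeep` is made of.  Let `Σ_{i<s} c_i g_i² = F_p` over `ℂ` and let `O ⊂ ℂ` be a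
valuation subring with `p ∈ 𝔪_O` at which the Gram matrix `Q_{ab} = Σ_i c_i g_{i,a} g_{i,b}` is NOT integral.  In the
maximal-minor model (`gsh_qf_model`: `g_i = Σ_j g_{i,a_j} h_j`, `h_j` `O`-integral and `δ`-normalised at the exponents `a_j`,
`Σ c_i g_i² = Σ_{j,j'} B_{jj'} h_j h_{j'}` with `B_{jj'} = Q_{a_j a_{j'}}`), the block `B` is then non-integral too (`Q = Σ B h h`
coefficientwise with `h` integral), and dividing by an entry `b` of `B` of maximal valuation and reducing modulo `𝔪_O` gives

  `gramDeep_nullForm`:  a NON-ZERO symmetric matrix `N̄` over the residue field `k` (characteristic `p`) and `r ≤ s`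
  polynomials `h̄_j ∈ k[X]`, supported on `U = ∪ supp g_i` and `δ`-normalised (hence linearly independent), with
  `Σ_{j,j'} N̄_{jj'} h̄_j h̄_{j'} = 0` in `k[X]`.

So every place of the residual class carries a genuine quadratic syzygy among `≤ s` independent sparse polynomials in
characteristic `p` (of rank `≥ 3`: a rank-`≤ 2` symmetric null form on independent polynomials vanishes) — the "border layer"
that a de-bordering argument must consume.  For `s = 3` it is a conic `h̄ h̄' = h̄''²`, i.e. the reduced span is `d·⟨m², mn, n²⟩`.
-/

namespace Summit.ValiantsHypothesis.ValiantsHypothesis.Theorems.SublinearShadowSketch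

open Polynomial Finset IsLocalRing Matrix
open scoped BigOperators
open Literature.NumberTheory.LFunctions
open Literature.RingTheory.Valuation

-- `Summit.ValiantsHypothesis.ValiantsHypothesis.…` is the tree's mandated single-conjunct layout (Sub = Summit).
set_option linter.dupNamespace false

/-- **The null form at a Gram-deep place.**  If `Σ_{i<s} c_i g_i² = F_p` over `ℂ` and the Gram matrix
`(Σ_i c_i g_{i,a} g_{i,b})_{a,b}` has an entry outside a valuation subring `O ⊂ ℂ` with `p ∈ 𝔪_O`, then over the residue field
`k` of `O` there are `r ≤ s` polynomials `h̄_j`, supported on `∪ supp g_i` and `δ`-normalised at distinct exponents `a_j`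
(`h̄_{j,a_{j'}} = δ_{jj'}`), and a non-zero symmetric `N̄ ∈ k^{r×r}` with `Σ_{j,j'} N̄_{jj'} h̄_j h̄_{j'} = 0`. -/
theorem gramDeep_nullForm (p : ℕ) [Fact p.Prime] (s : ℕ) (c : Fin s → ℂ) (g : Fin s → ℂ[X])
    (hrep : (∑ i, C (c i) * g i ^ 2) = ∑ m ∈ Finset.range p, C ((legendreSym p m : ℤ) : ℂ) * X ^ m)
    (O : ValuationSubring ℂ) (_hpO : ((p : ℕ) : O) ∈ maximalIdeal O)
    (hdeep : ∃ a b : ℕ, (∑ i, c i * (g i).coeff a * (g i).coeff b) ∉ O) :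
    ∃ (r : ℕ) (a : Fin r → ℕ) (hb : Fin r → (ResidueField O)[X]) (N : Fin r → Fin r → ResidueField O),
      r ≤ s ∧ (∀ j, (hb j).support ⊆ Finset.univ.biUnion fun i => (g i).support) ∧
      (∀ j j', (hb j).coeff (a j') = if j = j' then 1 else 0) ∧
      (∀ j j', N j j' = N j' j) ∧ (∃ j j', N j j' ≠ 0) ∧
      (∑ j, ∑ j', C (N j j') * (hb j * hb j')) = 0 := by
  classical
  set ι : O →+* ℂ := algebraMap O ℂ with hι
  have hιinj : Function.Injective ι := IsFractionRing.injective O ℂ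
  set ρ : O →+* ResidueField O := residue O with hρ
  -- the integral quadratic-form model
  obtain ⟨r, a, h, hr, hhint, hhsupp, hδ, hg_expand, hqf⟩ := gsh_qf_model O s c g
  set B : Fin r → Fin r → ℂ := fun j j' => ∑ i, c i * (g i).coeff (a j) * (g i).coeff (a j') with hB
  have hBsym : ∀ j j', B j j' = B j' j := fun j j' => by
    simp only [hB]
    exact Finset.sum_congr rfl fun i _ => by ring
  -- (1) the block `B` is not integral: `Q_{ab} = Σ_{j,j'} B_{jj'} h_{j,a} h_{j',b}` with `h` integral
  have hQ : ∀ x y : ℕ, (∑ i, c i * (g i).coeff x * (g i).coeff y)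
      = ∑ j, ∑ j', B j j' * ((h j).coeff x * (h j').coeff y) := by
    intro x y
    have hcoef : ∀ i n, (g i).coeff n = ∑ j, (g i).coeff (a j) * (h j).coeff n := fun i n => by
      conv_lhs => rw [hg_expand i]
      rw [finsetSum_coeff]
      exact Finset.sum_congr rfl fun j _ => by rw [coeff_C_mul]
    have step : ∀ i, c i * (g i).coeff x * (g i).coeff y
        = ∑ j, ∑ j', c i * (g i).coeff (a j) * (g i).coeff (a j') * ((h j).coeff x * (h j').coeff y) := fun i => by
      have e : c i * (g i).coeff x * (g i).coeff y = c i * ((∑ j, (g i).coeff (a j) * (h j).coeff x)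
          * (∑ j', (g i).coeff (a j') * (h j').coeff y)) := by
        rw [← hcoef i x, ← hcoef i y]; ring
      rw [e, Finset.sum_mul_sum, Finset.mul_sum]
      refine Finset.sum_congr rfl fun j _ => ?_
      rw [Finset.mul_sum]
      refine Finset.sum_congr rfl fun j' _ => ?_
      ring
    rw [Finset.sum_congr rfl fun i _ => step i, Finset.sum_comm]
    refine Finset.sum_congr rfl fun j _ => ?_
    rw [Finset.sum_comm]
    refine Finset.sum_congr rfl fun j' _ => ?_
    rw [← Finset.sum_mul]
  have hBdeep : ∃ j j', B j j' ∉ O := by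
    by_contra hall
    push Not at hall
    obtain ⟨x, y, hxy⟩ := hdeep
    apply hxy
    rw [hQ x y]
    exact sum_mem fun j _ => sum_mem fun j' _ => mul_mem (hall j j') (mul_mem (hhint j x) (hhint j' y))
  -- (2) an entry `b` of `B` of maximal valuation; `N₀ = b⁻¹ B` is integral with an entry `1`, and `b⁻¹ ∈ 𝔪_O`
  obtain ⟨jm, -, hjm⟩ := Finset.exists_max_image (Finset.univ : Finset (Fin r × Fin r))
    (fun q => O.valuation (B q.1 q.2)) (by
      obtain ⟨j, j', _⟩ := hBdeep
      exact ⟨(j, j'), Finset.mem_univ _⟩)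
  set b : ℂ := B jm.1 jm.2 with hb
  have hbmax : ∀ j j', O.valuation (B j j') ≤ O.valuation b := fun j j' => hjm (j, j') (Finset.mem_univ _)
  have hbnot : b ∉ O := by
    obtain ⟨j, j', hjj'⟩ := hBdeep
    intro hbO
    apply hjj'
    rw [← O.valuation_le_one_iff] at hbO ⊢
    exact (hbmax j j').trans hbO
  have hb0 : b ≠ 0 := fun h0 => hbnot (h0 ▸ zero_mem O)
  have hvb0 : O.valuation b ≠ 0 := (Valuation.ne_zero_iff _).mpr hb0
  have hbinv : b⁻¹ ∈ O := by
    rcases O.mem_or_inv_mem b with h | h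
    · exact absurd h hbnot
    · exact h
  have hbinv_lt : O.valuation b⁻¹ < 1 := by
    rw [map_inv₀, inv_lt_one₀ (zero_lt_iff.mpr hvb0)]
    exact not_le.mp fun hle => hbnot ((O.valuation_le_one_iff b).mp hle)
  set N₀ : Fin r → Fin r → ℂ := fun j j' => b⁻¹ * B j j' with hN₀
  have hN₀int : ∀ j j', N₀ j j' ∈ O := fun j j' => by
    rw [← O.valuation_le_one_iff, hN₀]
    change O.valuation (b⁻¹ * B j j') ≤ 1
    rw [map_mul, map_inv₀]
    calc (O.valuation b)⁻¹ * O.valuation (B j j') ≤ (O.valuation b)⁻¹ * O.valuation b :=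
          mul_le_mul_right (hbmax j j') _
      _ = 1 := inv_mul_cancel₀ hvb0
  have hN₀one : N₀ jm.1 jm.2 = 1 := by
    simp only [hN₀]
    exact inv_mul_cancel₀ hb0
  -- the identity `Σ N₀ h h = b⁻¹ · F_p`
  have hqfN : (∑ j, ∑ j', C (N₀ j j') * (h j * h j'))
      = C b⁻¹ * ∑ m ∈ Finset.range p, C ((legendreSym p m : ℤ) : ℂ) * X ^ m := by
    rw [← hrep, hqf, Finset.mul_sum]
    refine Finset.sum_congr rfl fun j _ => ?_
    rw [Finset.mul_sum]
    refine Finset.sum_congr rfl fun j' _ => ?_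
    simp only [hN₀, C_mul]
    ring
  -- (3) lift to `O[X]` and reduce: the right-hand side dies because `b⁻¹ ∈ 𝔪_O`
  choose Hh hHh hHhsupp using fun j => dzs_exists_lift O (hhint j)
  set NO : Fin r → Fin r → O := fun j j' => ⟨N₀ j j', hN₀int j j'⟩ with hNO
  set binvO : O := ⟨b⁻¹, hbinv⟩ with hbinvO
  have hFmap : ((feketePolynomial p).map (Int.castRingHom O)).map ι
      = (feketePolynomial p).map (Int.castRingHom ℂ) := by
    rw [Polynomial.map_map, RingHom.ext_int (ι.comp (Int.castRingHom O)) (Int.castRingHom ℂ)]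
  have hidO : (∑ j, ∑ j', C (NO j j') * (Hh j * Hh j'))
      = C binvO * (feketePolynomial p).map (Int.castRingHom O) := by
    apply Polynomial.map_injective ι hιinj
    rw [Polynomial.map_mul, map_C, hFmap, map_feketePolynomial_complex, Polynomial.map_sum]
    have e1 : ∀ j, (∑ j', C (NO j j') * (Hh j * Hh j')).map ι = ∑ j', C (N₀ j j') * (h j * h j') := fun j => by
      rw [Polynomial.map_sum]
      refine Finset.sum_congr rfl fun j' _ => ?_
      rw [Polynomial.map_mul, Polynomial.map_mul, map_C, hHh, hHh]
      rfl
    rw [Finset.sum_congr rfl fun j _ => e1 j, hqfN]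
    rfl
  have hres0 : ρ binvO = 0 := by
    rw [hρ, residue_eq_zero_iff, O.valuation_lt_one_iff]
    exact hbinv_lt
  refine ⟨r, a, fun j => (Hh j).map ρ, fun j j' => ρ (NO j j'), hr, ?_, ?_, ?_, ?_, ?_⟩
  · intro j
    exact (support_map_subset _ _).trans (by rw [hHhsupp j]; exact hhsupp j)
  · intro j j'
    rw [coeff_map]
    have e : ι ((Hh j).coeff (a j')) = if j = j' then 1 else 0 := by
      rw [← coeff_map, hHh]; exact hδ j j'
    have e2 : (Hh j).coeff (a j') = if j = j' then 1 else 0 := by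
      apply hιinj
      rw [e]
      split_ifs <;> simp
    rw [e2]
    split_ifs <;> simp
  · intro j j'
    change ρ (NO j j') = ρ (NO j' j)
    congr 1
    apply Subtype.ext
    change b⁻¹ * B j j' = b⁻¹ * B j' j
    rw [hBsym]
  · refine ⟨jm.1, jm.2, ?_⟩
    have e : NO jm.1 jm.2 = 1 := Subtype.ext hN₀one
    show ρ (NO jm.1 jm.2) ≠ 0
    rw [e, map_one]
    exact one_ne_zero
  · have h := congrArg (Polynomial.map ρ) hidO
    rw [Polynomial.map_mul, map_C, hres0, C_0, zero_mul, Polynomial.map_sum] at h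
    rw [← h]
    refine Finset.sum_congr rfl fun j _ => ?_
    rw [Polynomial.map_sum]
    refine Finset.sum_congr rfl fun j' _ => ?_
    rw [Polynomial.map_mul, Polynomial.map_mul, map_C]

end Summit.ValiantsHypothesis.ValiantsHypothesis.Theorems.SublinearShadowSketch
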